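import Summits.CriticalPhenomena.PercolationContinuityZ3.Theorems.PercNearOneGluingNoHeavyQuantIndepBlobTruncatedMean
import Summits.CriticalPhenomena.PercolationContinuityZ3.Theorems.PercNearOneGluingNoHeavyQuantIndepBlobCloudClamp
import HarnessLib

/-!
# QUANT lane R8, Conjecture DIB\* for ALL-MEDIUM light clouds — any number of light blobs, each with `x·a ≤ 2j − C_H < 2a`,
# every floor `1/2 ≤ x < 1` (CONJECTURE (ALL-MEDIUM) of SMALL-CLOUD-G15 §11, via the truncated-mean theorem)

builds on p205010 (kernel theorem, internal audit signed; external expert review pending)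

Support file (`--supports stmt-CriticalPhenomena-4575`), QUANT lane census seat prim-quant-census-1 (gen 16), rung R8 of
`run/shared/lean/prim/quant/LADDER.md`; memo `run/shared/lean/prim/quant/prim-quant-census-1/TRUNCATED-MEAN-G16.md`.  Part (IX) of the cloud
series: (VII) `…TruncatedMeanIneq` + (VIII) `…TruncatedMean` prove `E[min(Λ, t)] > x·t` for every light cloud with credit `C_L > x·t` and sizes
`≤ t`; with `t = Cp/x` (`Cp = 2j − C_H` the shortfall the lights must cover) this is the truncated-mean condition `E[min(Λ, Cp/x)] > Cp` of
SMALL-CLOUD-G15 §10, which discharges the CLAMP certificate `IndepBlob.tail_ge_of_clampCert` (part IV, p258923) in the regime where every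
light is bigger than half the shortfall.  Theorems only, no definitions, no sorries, standard axioms.

* **`Quant.IndepBlob.tail_ge_of_allMedium`** — floor `1/2 ≤ x < 1`, gates in `[0,1]`; a cloud `L` of lights (gates `< x`; gates below `x²`
  allowed, they carry negative credit) off which every blob is heavy; every light MEDIUM: `C_H + x·a_k ≤ 2j < C_H + 2·a_k`; DIB\* credit
  `2j < C_H + Σ_L a·(p − x²)/(1 − x)` ⟹ `x ≤ P(N ≥ j+1)`.  ANY number of lights (two lights: `…TwoMediumLights`, p261101; two bins:
  `…TwoBins`, p261350 — both now special cases).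
* **`Quant.IndepBlob.dibStar_of_allMedium`** — the same in DIB\*'s binder shape (`…QuantDIBStar`): every blob below the floor is medium.
With census-1 g15's families the multi-light corner of DIB\* is now KERNEL whenever the light cloud is small (`Σ_L a ≤ j`), all-big
(`x·a_k > Cp` each) or all-medium; the mixed big/medium clouds and clouds with a light of size `≤ Cp/2` remain (LIGHT-DEC, `…QuantLightDEC`).

NOVELTY: as in part VII. [this work; this lane's census]; the gluing rows served: [cite: KozmaNitzan2024, Conjecture 3 (p. 15)]; product
weights [cite: Grimmett1999, §1.3 p. 10].
-/

namespace Summit.CriticalPhenomena.PercolationContinuityZ3.Theorems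

namespace Quant

namespace IndepBlob

open Finset

variable {κ : Type*} [Fintype κ] [DecidableEq κ]

/-! ### 18. All-medium light clouds -/

/-- **DIB\* FOR ALL-MEDIUM LIGHT CLOUDS (any number of lights).**  Gates in `[0,1]`, floor `1/2 ≤ x < 1`; a cloud `L` (gates `< x`) off which
every blob is heavy (`x ≤ p`); every light medium, `C_H + x·a_k ≤ 2j < C_H + 2·a_k`; DIB\* credit `2j < C_H + Σ_{k ∈ L} a_k·(p_k − x²)/(1 − x)`
⟹ `x ≤ P(N ≥ j+1)`.  Proof: the truncated-mean theorem at `t = Cp/x` makes the clamp certificate strict. [this work] -/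
theorem tail_ge_of_allMedium (p : κ → ℝ) (a : κ → ℕ) (x : ℝ) (hx : 1 / 2 ≤ x) (hx1 : x < 1)
    (hp0 : ∀ k, 0 ≤ p k) (hp1 : ∀ k, p k ≤ 1) (L : Finset κ) (hheavy : ∀ k, k ∉ L → x ≤ p k) (hlight : ∀ k ∈ L, p k < x) (j : ℕ)
    (hmid : ∀ k ∈ L, (2 * j : ℝ) < (∑ i ∈ Finset.univ \ L, (a i : ℝ) * p i) + 2 * (a k : ℝ))
    (hmed : ∀ k ∈ L, (∑ i ∈ Finset.univ \ L, (a i : ℝ) * p i) + x * (a k : ℝ) ≤ 2 * j)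
    (hcredit : (2 * j : ℝ) < (∑ i ∈ Finset.univ \ L, (a i : ℝ) * p i) + ∑ k ∈ L, (a k : ℝ) * ((p k - x ^ 2) / (1 - x))) :
    x ≤ ∑ s : Finset κ, (∏ k, if k ∈ s then p k else 1 - p k) * (if j + 1 ≤ ∑ k ∈ s, a k then (1 : ℝ) else 0) := by
  have hx0 : 0 < x := by linarith
  have h1x : 0 < 1 - x := by linarith
  set CH : ℝ := ∑ i ∈ Finset.univ \ L, (a i : ℝ) * p i with hCH
  refine tail_ge_of_clampCert p a x hx0 hx1 hp0 hp1 L hheavy j hmid ?_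
  set Cp : ℝ := 2 * j - CH with hCp
  set wL : Finset κ → ℝ := fun S => ∏ k ∈ L, (if k ∈ S then p k else 1 - p k) with hwL
  change x * Cp * ∏ k ∈ L, (1 - p k) <
    ∑ S ∈ L.powerset, wL S * max 0 (min (x * (((∑ k ∈ S, a k : ℕ) : ℝ) - Cp)) ((1 - x) * Cp))
  have hwL0 : ∀ S, 0 ≤ wL S := fun S => weightU_nonneg p L (fun k _ => hp0 k) (fun k _ => hp1 k) S
  have hRHS0 : 0 ≤ ∑ S ∈ L.powerset, wL S * max 0 (min (x * (((∑ k ∈ S, a k : ℕ) : ℝ) - Cp)) ((1 - x) * Cp)) :=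
    Finset.sum_nonneg fun S _ => mul_nonneg (hwL0 S) (le_max_left _ _)
  rcases L.eq_empty_or_nonempty with hL0 | ⟨k₀, hk₀⟩
  · -- empty cloud: the shortfall is negative
    have hCpneg : Cp < 0 := by rw [hL0, Finset.sum_empty, add_zero] at hcredit; rw [hCp]; linarith
    have hLHS : x * Cp * ∏ k ∈ L, (1 - p k) < 0 := by
      rw [hL0, Finset.prod_empty, mul_one]; exact mul_neg_of_pos_of_neg hx0 hCpneg
    exact hLHS.trans_le hRHS0
  -- the target `t = Cp / x ≥ every light`
  have hCp0 : 0 ≤ Cp := by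
    have h1 := hmed k₀ hk₀
    have h2 : (0 : ℝ) ≤ (a k₀ : ℝ) := Nat.cast_nonneg (a k₀)
    rw [hCp]; nlinarith
  set t : ℝ := Cp / x with ht
  have hxt : x * t = Cp := by rw [ht]; field_simp
  have ht0 : 0 ≤ t := div_nonneg hCp0 hx0.le
  have hbt : ∀ k ∈ L, (a k : ℝ) ≤ t := by
    intro k hk
    rw [ht, le_div_iff₀ hx0]
    have := hmed k hk; rw [hCp]; linarith
  -- THE TRUNCATED-MEAN THEOREM, strict form: `Cp < E[min(Λ, Cp/x)]`
  have hTM := (truncMean_ge_min x hx hx1 p (fun k => (a k : ℝ)) L.card L rfl t ht0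
    (fun k hk => ⟨hp0 k, hlight k hk⟩) (fun k _ => Nat.cast_nonneg (a k)) hbt).2
    (by rw [hxt, hCp]; linarith)
  rw [hxt] at hTM
  -- termwise: `w(S)·max(0, min(x(a(S) − Cp), (1 − x)Cp)) ≥ w(S)·(x·min(a(S), t) − x·Cp)`, and `≥ 0` on the empty outcome
  have hterm : ∀ S ∈ L.powerset,
      wL S * (x * min (∑ k ∈ S, (a k : ℝ)) t - x * Cp) + (if S = ∅ then wL S * (x * Cp) else 0) ≤
        wL S * max 0 (min (x * (((∑ k ∈ S, a k : ℕ) : ℝ) - Cp)) ((1 - x) * Cp)) := by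
    intro S _
    by_cases hS0 : S = ∅
    · subst hS0
      rw [if_pos rfl, Finset.sum_empty, min_eq_left ht0, mul_zero, zero_sub]
      have : 0 ≤ wL ∅ * max 0 (min (x * (((∑ k ∈ (∅ : Finset κ), a k : ℕ) : ℝ) - Cp)) ((1 - x) * Cp)) :=
        mul_nonneg (hwL0 ∅) (le_max_left _ _)
      linarith
    · rw [if_neg hS0, add_zero]
      refine mul_le_mul_of_nonneg_left ?_ (hwL0 S)
      have e : x * min (∑ k ∈ S, (a k : ℝ)) t - x * Cp = min (x * (((∑ k ∈ S, a k : ℕ) : ℝ) - Cp)) ((1 - x) * Cp) := by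
        rw [mul_min_of_nonneg _ _ hx0.le, hxt, ← min_sub_sub_right, Nat.cast_sum]
        congr 1 <;> ring
      rw [e]
      exact le_max_right _ _
  have hsum := Finset.sum_le_sum hterm
  rw [Finset.sum_add_distrib, Finset.sum_ite_eq' L.powerset (∅ : Finset κ) (fun S => wL S * (x * Cp)),
    if_pos (Finset.empty_mem_powerset L)] at hsum
  have e1 : ∑ S ∈ L.powerset, wL S * (x * min (∑ k ∈ S, (a k : ℝ)) t - x * Cp) =
      x * (∑ S ∈ L.powerset, wL S * min (∑ k ∈ S, (a k : ℝ)) t) - x * Cp := by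
    have e2 : ∀ S ∈ L.powerset, wL S * (x * min (∑ k ∈ S, (a k : ℝ)) t - x * Cp) =
        x * (wL S * min (∑ k ∈ S, (a k : ℝ)) t) - x * Cp * wL S := fun S _ => by ring
    rw [Finset.sum_congr rfl e2, Finset.sum_sub_distrib, ← Finset.mul_sum, ← Finset.mul_sum, sum_powerset_weight, mul_one]
  rw [e1] at hsum
  have hw0 : wL ∅ = ∏ k ∈ L, (1 - p k) := Finset.prod_congr rfl fun k _ => by rw [if_neg (Finset.notMem_empty k)]
  rw [hw0] at hsum
  have hxTM : x * Cp < x * ∑ S ∈ L.powerset, wL S * min (∑ k ∈ S, (a k : ℝ)) t := mul_lt_mul_of_pos_left hTM hx0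
  linarith

/-- **CONJECTURE DIB\* FOR ALL-MEDIUM LIGHT CLOUDS** (DIB\*'s binder shape, `…QuantDIBStar`): floor `1/2 ≤ x < 1`, gates in `[0,1]`,
every blob below the floor MEDIUM — `C_H + x·a_k ≤ 2j < C_H + 2·a_k` with `C_H = Σ_{x ≤ g} a·g` —, and the DIB\* credit
`2j < Σ_k a_k·(g_k | (g_k − x²)/(1 − x))` ⟹ `x ≤ P(Σ_{open} a ≥ j+1)`.  Any number of lights. [this work] -/
theorem dibStar_of_allMedium (x : ℝ) (hx : 1 / 2 ≤ x) (hx1 : x < 1) (a : κ → ℕ) (g : κ → ℝ) (j : ℕ)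
    (hg : ∀ k, 0 ≤ g k ∧ g k ≤ 1)
    (hmid : ∀ k, g k < x → (2 * j : ℝ) < (∑ i ∈ Finset.univ.filter (fun i => x ≤ g i), (a i : ℝ) * g i) + 2 * (a k : ℝ))
    (hmed : ∀ k, g k < x → (∑ i ∈ Finset.univ.filter (fun i => x ≤ g i), (a i : ℝ) * g i) + x * (a k : ℝ) ≤ 2 * j)
    (hcredit : (2 * j : ℝ) < ∑ k, (a k : ℝ) * (if x ≤ g k then g k else (g k - x ^ 2) / (1 - x))) :
    x ≤ ∑ W : Finset κ, (∏ k, if k ∈ W then g k else 1 - g k) * (if j + 1 ≤ ∑ k ∈ W, a k then (1 : ℝ) else 0) := by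
  set L : Finset κ := Finset.univ.filter (fun k => g k < x) with hL
  have hmemL : ∀ k, k ∈ L ↔ g k < x := fun k => by simp [hL]
  have hUeq : Finset.univ \ L = Finset.univ.filter (fun i => x ≤ g i) := by
    ext i; simp [hL, not_lt]
  have hsplit : ∑ k, (a k : ℝ) * (if x ≤ g k then g k else (g k - x ^ 2) / (1 - x)) =
      (∑ k ∈ Finset.univ \ L, (a k : ℝ) * g k) + ∑ k ∈ L, (a k : ℝ) * ((g k - x ^ 2) / (1 - x)) := by
    rw [← Finset.sum_sdiff (Finset.subset_univ L)]
    congr 1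
    · refine Finset.sum_congr rfl fun k hk => ?_
      have hkL : k ∉ L := (Finset.mem_sdiff.1 hk).2
      rw [if_pos (not_lt.1 fun h => hkL ((hmemL k).2 h))]
    · refine Finset.sum_congr rfl fun k hk => ?_
      rw [if_neg (not_le.2 ((hmemL k).1 hk))]
  rw [hsplit] at hcredit
  rw [← hUeq] at hmid hmed
  exact tail_ge_of_allMedium g a x hx hx1 (fun k => (hg k).1) (fun k => (hg k).2) L
    (fun k hk => not_lt.1 fun h => hk ((hmemL k).2 h)) (fun k hk => (hmemL k).1 hk) j
    (fun k hk => hmid k ((hmemL k).1 hk)) (fun k hk => hmed k ((hmemL k).1 hk)) hcredit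

end IndepBlob

end Quant

end Summit.CriticalPhenomena.PercolationContinuityZ3.Theorems
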